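import Literature.Barriers.CriticalPhenomena.SubexponentialGrowthZdProofs
import Mathlib.Combinatorics.SimpleGraph.Acyclic
import Mathlib.Combinatorics.SimpleGraph.DegreeSum
import HarnessLib

/-!
# Bags and leaders in a forest of minimal degree three: the quotient is a forest whose degrees
# exceed the bag sizes — the deterministic core of the forest `Φ` in the proof of Timár 2006,
# Thm. 5.5

Barrier catalogue `Literature/Barriers/CriticalPhenomena/`; a deterministic brick of the
programme proving Timár's Thm. 5.5 (`Timar2006_finiteLevelUnion`,
`TimarCriticalNonunimodular.lean`). In the proof of Thm. 5.5 (Á. Timár, *Percolation on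
nonunimodular transitive graphs*, Ann. Probab. 34 (2006) 2344–2364, §5, pp. 2359–2360) the forest
`F(L₀)` (infinite components, all degrees `≥ 3`) is thinned to a forest of larger expected degree:

> "Choose an invariant partition of `F` into finite bags so that the expected number of bags that
> a bag on a fixed vertex is adjacent to is `> 2μ`. This can be done by means of an "extra"
> percolation on `V(F)` with a sufficiently low density of open vertices and then by defining a
> bag as the set of vertices that are closest to a particular open vertex in the extra percolation
> (in case of ties, decide by a random uniform choice). Then we can choose the "leader" of this bag
> to be the open vertex of the bag by the extra percolation. Connect the leader of each bag to the
> leaders of the adjacent bags. We defined a forest `Φ(L₀)` on the leaders …"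

We formalise the deterministic content, with ties broken by LABELS OF THE LEADERS (a labelling
`lab` injective on the set `S` of open vertices) — a tie-breaking rule under which bags are
connected: for a forest `F`, a set `S` of leaders and `lab`,

* `IsLeaderOf F S lab v u` — `u ∈ S` minimises `(dist_F(v, ·), lab ·)` among the leaders of the
  component of `v`; leaders are unique (`IsLeaderOf.unique`), exist in locally finite forests as
  soon as the component of `v` contains a leader (`exists_isLeaderOf`), and **bags are connected**:
  the `F`-geodesic from `v` to its leader stays in the bag (`IsLeaderOf.exists_walk`);
* `bagGraph F S lab` — "connect the leader of each bag to the leaders of the adjacent bags";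
  **it is acyclic when `F` is** (`bagGraph_isAcyclic`: a cycle of bags lifts, through the connected
  bags, to a walk in `F` returning to the far end of a crossing edge without using it — but every
  edge of a forest is a bridge);
* **the degree of a leader in `bagGraph` is at least `|bag| + 2`** when its bag is finite and all
  its vertices have `F`-degree `≥ 3` (`ncard_add_two_le_encard_neighborSet_bagGraph`): the bag
  induces a finite tree, so it has `Σ deg - 2(|bag| - 1) ≥ |bag| + 2` outgoing edges
  (Lyons–Peres 2016, Exercise 7.3), and distinct outgoing edges lead to distinct bags (two edges
  between two bags would close a cycle in `F`).

## References

* Á. Timár, Ann. Probab. 34 (2006) 2344–2364 (arXiv:math/0702875), §5, proof of Thm. 5.5 (bags,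
  leaders, `Φ(L₀)`). [Timar2006]
* R. Lyons, Y. Peres, *Probability on Trees and Networks*, CUP 2016, Exercise 7.3
  (`|∂_V K| ≥ |K ∩ B| + 2` for a finite set `K` in a tree without leaves). [LyonsPeres2016]
-/

namespace Literature.Barriers.CriticalPhenomena

open SimpleGraph

variable {V : Type*}

/-! ### Leaders and bags -/

section Defs

variable (F : SimpleGraph V) (S : Set V) (lab : V → ℝ)

/-- The lexicographic preference of `v` for the leader `s` over `s'`: closer in `F`, ties broken
by the label ("closest to a particular open vertex … in case of ties, decide by …").
[cite: Timar2006, Thm. 5.5 (proof: bags, ties)] -/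
def LeaderKeyLE (v s s' : V) : Prop :=
  F.edist v s < F.edist v s' ∨ (F.edist v s = F.edist v s' ∧ lab s ≤ lab s')

/-- **`u` is the leader of `v`** (`v` lies in the bag of `u`): `u ∈ S` lies in the component of
`v` and is preferred to every leader of that component.
[cite: Timar2006, Thm. 5.5 (proof: "a bag as the set of vertices that are closest to a particular open vertex")] -/
def IsLeaderOf (v u : V) : Prop :=
  u ∈ S ∧ F.Reachable v u ∧ ∀ s ∈ S, F.Reachable v s → LeaderKeyLE F lab v u s

/-- **The graph on the leaders**: "connect the leader of each bag to the leaders of the adjacent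
bags". [cite: Timar2006, Thm. 5.5 (proof: the forest Φ(L₀) on the leaders)] -/
def bagGraph : SimpleGraph V where
  Adj u u' := u ≠ u' ∧ ∃ v v', F.Adj v v' ∧ IsLeaderOf F S lab v u ∧ IsLeaderOf F S lab v' u'
  symm := ⟨fun _ _ ⟨hne, v, v', hadj, hv, hv'⟩ => ⟨hne.symm, v', v, hadj.symm, hv', hv⟩⟩
  loopless := ⟨fun _ h => h.1 rfl⟩

end Defs

section Basic

variable {F : SimpleGraph V} {S : Set V} {lab : V → ℝ}

/-- A leader belongs to `S`. [folklore] -/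
theorem IsLeaderOf.mem {v u : V} (h : IsLeaderOf F S lab v u) : u ∈ S := h.1

/-- A leader lies in the component of its followers. [folklore] -/
theorem IsLeaderOf.reachable {v u : V} (h : IsLeaderOf F S lab v u) : F.Reachable v u := h.2.1

/-- The distance to the leader is finite. [folklore] -/
theorem IsLeaderOf.edist_ne_top {v u : V} (h : IsLeaderOf F S lab v u) : F.edist v u ≠ ⊤ :=
  fun htop => h.reachable.elim fun p => (lt_of_le_of_lt (edist_le p) (WithTop.coe_lt_top p.length)).ne htop

/-- **Leaders are unique** (`lab` injective on `S`). [folklore] -/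
theorem IsLeaderOf.unique (hlab : Set.InjOn lab S) {v u u' : V} (h : IsLeaderOf F S lab v u)
    (h' : IsLeaderOf F S lab v u') : u = u' := by
  have h1 := h.2.2 u' h'.1 h'.2.1
  have h2 := h'.2.2 u h.1 h.2.1
  unfold LeaderKeyLE at h1 h2
  have hl : lab u = lab u' := by
    rcases h1 with h1 | ⟨h1, h1'⟩
    · rcases h2 with h2 | ⟨h2, -⟩
      · exact absurd (h1.trans h2) (lt_irrefl _)
      · exact absurd (h2 ▸ h1) (lt_irrefl _)
    · rcases h2 with h2 | ⟨-, h2'⟩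
      · exact absurd (h1 ▸ h2) (lt_irrefl _)
      · exact le_antisymm h1' h2'
  exact hlab h.1 h'.1 hl

/-- **A leader leads itself.** [folklore] -/
theorem isLeaderOf_self {u : V} (hu : u ∈ S) : IsLeaderOf F S lab u u := by
  refine ⟨hu, Reachable.refl u, fun s _ _ => ?_⟩
  by_cases hsu : s = u
  · subst hsu
    exact Or.inr ⟨rfl, le_rfl⟩
  · exact Or.inl (by rw [edist_self]; exact edist_pos_of_ne (Ne.symm hsu))

/-- The bag of a leader `u ∈ S` consists of `u`'s followers; `u` itself is its only leader
element… precisely: a leader in the bag of `u` is `u`. [folklore] -/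
theorem IsLeaderOf.eq_of_mem (hlab : Set.InjOn lab S) {v u : V} (h : IsLeaderOf F S lab v u)
    (hv : v ∈ S) : v = u :=
  (isLeaderOf_self hv).unique hlab h |>.symm |> Eq.symm

end Basic

/-! ### Existence of leaders in locally finite forests -/

section Existence

variable {F : SimpleGraph V} {S : Set V} {lab : V → ℝ}

/-- **Leaders exist**: in a locally finite graph, if the component of `v` contains a point of
`S` then `v` has a leader (the distances to `S` attain a minimum `d`; the finitely many points
of `S` at distance `d` contain one of least label). [folklore] -/
theorem exists_isLeaderOf (hF : ∀ x, (F.neighborSet x).Finite) {v s₀ : V} (hs₀ : s₀ ∈ S)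
    (hvs₀ : F.Reachable v s₀) : ∃ u, IsLeaderOf F S lab v u := by
  classical
  haveI : F.LocallyFinite := fun x => (hF x).fintype
  -- the minimal distance `d` from `v` to `S`
  have hex : ∃ d : ℕ, ∃ s ∈ S, F.edist v s = d := by
    obtain ⟨p, hp⟩ := hvs₀.exists_walk_length_eq_edist
    exact ⟨p.length, s₀, hs₀, hp.symm⟩
  set d := Nat.find hex with hd
  obtain ⟨s₁, hs₁, hds₁⟩ : ∃ s ∈ S, F.edist v s = d := Nat.find_spec hex
  have hmin : ∀ s ∈ S, (d : ℕ∞) ≤ F.edist v s := by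
    intro s hs
    by_cases htop : F.edist v s = ⊤
    · rw [htop]; exact le_top
    · obtain ⟨m, hm⟩ := ENat.ne_top_iff_exists.1 htop
      rw [← hm]
      have : d ≤ m := Nat.find_min' hex ⟨s, hs, hm.symm⟩
      exact Nat.cast_le.2 this
  -- the finite nonempty set of nearest leaders
  set T : Set V := {s | s ∈ S ∧ F.edist v s = d} with hT
  have hTfin : T.Finite := by
    refine (graphBall_finite F v d).subset fun s hs => ?_
    obtain ⟨p, hp⟩ := exists_walk_of_edist_eq_coe hs.2
    exact ⟨p, hp.le⟩
  have hTne : T.Nonempty := ⟨s₁, hs₁, hds₁⟩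
  obtain ⟨u, huT, humin⟩ := hTfin.exists_minimalFor lab T hTne
  refine ⟨u, huT.1, ?_, fun s hs _ => ?_⟩
  · exact reachable_of_edist_ne_top (by rw [huT.2]; exact WithTop.coe_ne_top)
  · rcases (hmin s hs).lt_or_eq with hlt | heq
    · exact Or.inl (huT.2 ▸ hlt)
    · refine Or.inr ⟨huT.2.trans heq, ?_⟩
      by_contra hls
      push Not at hls
      exact absurd (humin ⟨hs, heq.symm⟩ hls.le) (not_le.2 hls)

end Existence

/-! ### Bags are connected: the geodesic to the leader stays in the bag -/

section Connected

variable {F : SimpleGraph V} {S : Set V} {lab : V → ℝ}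

/-- **One step towards the leader stays in the bag**: if `u ≠ v` leads `v`, some neighbour `v'`
of `v`, one step closer to `u`, is also led by `u`. [cite: Timar2006, Thm. 5.5 (proof: bags)] -/
theorem IsLeaderOf.exists_adj {v u : V} (h : IsLeaderOf F S lab v u) (hvu : v ≠ u) :
    ∃ v', F.Adj v v' ∧ IsLeaderOf F S lab v' u ∧ F.edist v' u + 1 = F.edist v u := by
  obtain ⟨p, hp⟩ := h.reachable.exists_walk_length_eq_edist
  cases p with
  | nil => exact absurd rfl hvu
  | @cons _ v' _ hadj q =>
    have hlen : (q.length : ℕ∞) + 1 = F.edist v u := by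
      rw [← hp, Walk.length_cons, Nat.cast_add, Nat.cast_one]
    have hq : F.edist v' u ≤ q.length := edist_le q
    have htri : F.edist v u ≤ F.edist v' u + 1 := by
      calc F.edist v u ≤ F.edist v v' + F.edist v' u := SimpleGraph.edist_triangle
        _ ≤ 1 + F.edist v' u := add_le_add (edist_le (Walk.cons hadj Walk.nil) |>.trans (by simp)) le_rfl
        _ = F.edist v' u + 1 := add_comm _ _
    have heq : F.edist v' u + 1 = F.edist v u := by
      refine le_antisymm ?_ htri
      calc F.edist v' u + 1 ≤ (q.length : ℕ∞) + 1 := add_le_add hq le_rfl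
        _ = F.edist v u := hlen
    have hfin' : F.edist v' u ≠ ⊤ := fun htop => h.edist_ne_top (by rw [← heq, htop, top_add])
    refine ⟨v', hadj, ⟨h.1, ⟨q⟩, fun s hs hreach => ?_⟩, heq⟩
    have hvs : F.Reachable v s := (Adj.reachable hadj).trans hreach
    have key := h.2.2 s hs hvs
    have htri_s : F.edist v s ≤ F.edist v' s + 1 := by
      calc F.edist v s ≤ F.edist v v' + F.edist v' s := SimpleGraph.edist_triangle
        _ ≤ 1 + F.edist v' s := add_le_add (edist_le (Walk.cons hadj Walk.nil) |>.trans (by simp)) le_rfl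
        _ = F.edist v' s + 1 := add_comm _ _
    unfold LeaderKeyLE at key ⊢
    by_contra hno
    rw [not_or, not_lt, not_and, not_le] at hno
    obtain ⟨hle, hlab⟩ := hno
    rcases hle.lt_or_eq with hlt | heqs
    · -- `v'` strictly closer to `s` than to `u`: then `v` too
      have : F.edist v s < F.edist v u := by
        calc F.edist v s ≤ F.edist v' s + 1 := htri_s
          _ < F.edist v' u + 1 := (WithTop.add_lt_add_iff_right WithTop.one_ne_top).2 hlt
          _ = F.edist v u := heq
      rcases key with k | ⟨k, -⟩
      · exact absurd (k.trans this) (lt_irrefl _)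
      · exact absurd (k ▸ this) (lt_irrefl _)
    · -- a tie at `v'`, with `lab s < lab u`: then a tie at `v`, contradicting the tie-break
      have hls := hlab heqs.symm
      have hle' : F.edist v s ≤ F.edist v u := by
        calc F.edist v s ≤ F.edist v' s + 1 := htri_s
          _ = F.edist v' u + 1 := by rw [heqs]
          _ = F.edist v u := heq
      rcases key with k | ⟨-, k⟩
      · exact absurd (k.trans_le hle') (lt_irrefl _)
      · exact absurd hls (not_lt.2 k)

/-- **Bags are connected**: from every `v` in the bag of `u` there is a walk to `u` inside the bag
(the geodesic). [cite: Timar2006, Thm. 5.5 (proof: bags)] -/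
theorem IsLeaderOf.exists_walk {v u : V} (h : IsLeaderOf F S lab v u) :
    ∃ p : F.Walk v u, ∀ z ∈ p.support, IsLeaderOf F S lab z u := by
  -- induction on the finite distance to the leader
  obtain ⟨n, hn⟩ := WithTop.ne_top_iff_exists.1 h.edist_ne_top
  induction n generalizing v with
  | zero =>
    have hvu : v = u := by
      have : F.edist v u = 0 := by rw [← hn]; rfl
      exact edist_eq_zero_iff.1 this
    subst hvu
    exact ⟨Walk.nil, by simpa using h⟩
  | succ n ih =>
    have hvu : v ≠ u := by
      rintro rfl
      rw [edist_self] at hn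
      exact Nat.cast_ne_zero.2 (Nat.succ_ne_zero n) hn
    obtain ⟨v', hadj, hv', hd⟩ := h.exists_adj hvu
    have hn' : (n : ℕ∞) = F.edist v' u := by
      have : F.edist v' u + 1 = (n : ℕ∞) + 1 := by rw [hd, ← hn]; rfl
      exact ((WithTop.add_right_inj WithTop.one_ne_top).1 this).symm
    obtain ⟨q, hq⟩ := ih hv' hn'
    refine ⟨Walk.cons hadj q, fun z hz => ?_⟩
    rw [Walk.support_cons, List.mem_cons] at hz
    rcases hz with rfl | hz
    · exact h
    · exact hq z hz

/-- Two vertices of a bag are joined inside the bag. [folklore] -/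
theorem IsLeaderOf.exists_walk_of_isLeaderOf {v w u : V} (hv : IsLeaderOf F S lab v u)
    (hw : IsLeaderOf F S lab w u) :
    ∃ p : F.Walk v w, ∀ z ∈ p.support, IsLeaderOf F S lab z u := by
  obtain ⟨p, hp⟩ := hv.exists_walk
  obtain ⟨q, hq⟩ := hw.exists_walk
  refine ⟨p.append q.reverse, fun z hz => ?_⟩
  rw [Walk.mem_support_append_iff, Walk.support_reverse, List.mem_reverse] at hz
  exact hz.elim (hp z) (hq z)

/-- An edge of a walk inside a bag has both endpoints in the bag; in particular an edge between
two different bags is not among its edges. [folklore] -/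
theorem not_mem_edges_of_support {v w a b : V} {u : V} (p : F.Walk v w)
    (hp : ∀ z ∈ p.support, IsLeaderOf F S lab z u) (hlab : Set.InjOn lab S)
    {u' : V} (hb : IsLeaderOf F S lab b u') (hne : u ≠ u') : s(a, b) ∉ p.edges := by
  intro he
  exact hne ((hp b (p.snd_mem_support_of_mem_edges he)).unique hlab hb)

end Connected

/-! ### The graph on the leaders is a forest -/

section Forest

variable {F : SimpleGraph V} {S : Set V} {lab : V → ℝ}

/-- **Lifting walks of bags to walks of `F`**: a walk in `bagGraph` avoiding the bag-edge `uu'`,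
from the bag of `a` to the bag of `b`, lifts to a walk of `F` from `a` to `b` avoiding any fixed
`F`-edge `vv'` crossing between the bags of `u` and `u'`. [folklore] -/
theorem exists_walk_lift (hlab : Set.InjOn lab S) {u u' v v' : V} (hv : IsLeaderOf F S lab v u)
    (hv' : IsLeaderOf F S lab v' u') (huu' : u ≠ u') :
    ∀ {w₀ w₁ : V} (P : ((bagGraph F S lab).deleteEdges {s(u, u')}).Walk w₀ w₁) (a b : V),
      IsLeaderOf F S lab a w₀ → IsLeaderOf F S lab b w₁ → ∃ Q : F.Walk a b, s(v, v') ∉ Q.edges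
  | _, _, .nil, a, b, ha, hb => by
    obtain ⟨Q, hQ⟩ := ha.exists_walk_of_isLeaderOf hb
    refine ⟨Q, fun he => ?_⟩
    -- both endpoints of the edge would be in the bag of `w₀`
    have h1 := (hQ v (Q.fst_mem_support_of_mem_edges he)).unique hlab hv
    have h2 := (hQ v' (Q.snd_mem_support_of_mem_edges he)).unique hlab hv'
    exact huu' (h1.symm.trans h2)
  | w₀, w₁, .cons (v := w) hadj P, a, b, ha, hb => by
    rw [deleteEdges_adj] at hadj
    obtain ⟨⟨-, c, d, hcd, hc, hd⟩, hne⟩ := hadj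
    obtain ⟨Q₁, hQ₁⟩ := ha.exists_walk_of_isLeaderOf hc
    obtain ⟨Q₂, hQ₂⟩ := exists_walk_lift hlab hv hv' huu' P d b hd hb
    refine ⟨Q₁.append (Walk.cons hcd Q₂), fun he => ?_⟩
    rw [Walk.edges_append, List.mem_append, Walk.edges_cons, List.mem_cons] at he
    rcases he with he | he | he
    · have h1 := (hQ₁ v (Q₁.fst_mem_support_of_mem_edges he)).unique hlab hv
      have h2 := (hQ₁ v' (Q₁.snd_mem_support_of_mem_edges he)).unique hlab hv'
      exact huu' (h1.symm.trans h2)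
    · -- the crossing edge `cd` is the edge `vv'`: then `{w₀, w} = {u, u'}`
      apply hne
      rw [Set.mem_singleton_iff]
      rcases Sym2.eq_iff.1 he with ⟨rfl, rfl⟩ | ⟨rfl, rfl⟩
      · rw [hc.unique hlab hv, hd.unique hlab hv']
      · rw [hc.unique hlab hv', hd.unique hlab hv, Sym2.eq_swap]
    · exact hQ₂ he

/-- **The graph on the leaders is acyclic when `F` is** ("We defined a forest `Φ(L₀)` on the
leaders"). [cite: Timar2006, Thm. 5.5 (proof: Φ(L₀) is a forest)] -/
theorem bagGraph_isAcyclic (hF : F.IsAcyclic) (hlab : Set.InjOn lab S) :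
    (bagGraph F S lab).IsAcyclic := by
  rw [isAcyclic_iff_forall_adj_isBridge]
  rintro u u' ⟨huu', v, v', hvv', hv, hv'⟩
  rw [isBridge_iff]
  rintro ⟨P⟩
  obtain ⟨Q, hQ⟩ := exists_walk_lift hlab hv hv' huu' P v v' hv hv'
  have hreach : (F.deleteEdges {s(v, v')}).Reachable v v' :=
    reachable_deleteEdges_iff_exists_walk.2 ⟨Q, hQ⟩
  exact (isAcyclic_iff_forall_adj_isBridge.1 hF hvv') hreach

end Forest

/-! ### The degree of a leader exceeds the size of its bag -/

section Count

variable {F : SimpleGraph V} {S : Set V} {lab : V → ℝ}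

/-- **Two different `F`-edges leaving a bag lead to different bags** (else they would close a
cycle through the two connected bags). [folklore] -/
theorem leader_ne_of_ne (hF : F.IsAcyclic) (hlab : Set.InjOn lab S) {u u₁ v₁ w₁ v₂ w₂ : V}
    (hv₁ : IsLeaderOf F S lab v₁ u) (hv₂ : IsLeaderOf F S lab v₂ u) (hw₁ : IsLeaderOf F S lab w₁ u₁)
    (hw₂ : IsLeaderOf F S lab w₂ u₁) (hu : u ≠ u₁) (h₁ : F.Adj v₁ w₁) (h₂ : F.Adj v₂ w₂)
    (hne : s(v₁, w₁) ≠ s(v₂, w₂)) : False := by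
  -- `v₁ → (bag u) → v₂ → w₂ → (bag u₁) → w₁` avoids the edge `v₁w₁`
  obtain ⟨P, hP⟩ := hv₁.exists_walk_of_isLeaderOf hv₂
  obtain ⟨Q, hQ⟩ := hw₂.exists_walk_of_isLeaderOf hw₁
  have hwalk : ∃ R : F.Walk v₁ w₁, s(v₁, w₁) ∉ R.edges := by
    refine ⟨P.append (Walk.cons h₂ Q), fun he => ?_⟩
    rw [Walk.edges_append, List.mem_append, Walk.edges_cons, List.mem_cons] at he
    rcases he with he | he | he
    · exact hu ((hP w₁ (P.snd_mem_support_of_mem_edges he)).unique hlab hw₁)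
    · exact hne he
    · exact hu.symm ((hQ v₁ (Q.fst_mem_support_of_mem_edges he)).unique hlab hv₁)
  exact (isAcyclic_iff_forall_adj_isBridge.1 hF h₁) (reachable_deleteEdges_iff_exists_walk.2 hwalk)

/-- **Timár's bags versus Lyons–Peres, Exercise 7.3, PROVED**: in an acyclic, locally finite
`F` with labels injective on `S`, if the bag `A` of the leader `u ∈ S` is finite and every vertex
of `A` has `F`-degree at least `3`, then `u` has at least `|A| + 2` neighbours in the graph on
the leaders: `A` induces a finite tree, so the number of `F`-edges leaving `A` is
`Σ_{v ∈ A} deg v - 2(|A| - 1) ≥ |A| + 2`, and distinct leaving edges lead to distinct bags.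
[cite: LyonsPeres2016, Exercise 7.3] [cite: Timar2006, Thm. 5.5 (proof: "the expected number of bags that a bag on a fixed vertex is adjacent to")] -/
theorem ncard_add_two_le_encard_neighborSet_bagGraph (hF : F.IsAcyclic)
    (hloc : ∀ x, (F.neighborSet x).Finite) (hlab : Set.InjOn lab S) {u : V} (hu : u ∈ S)
    (hfin : Set.Finite {v | IsLeaderOf F S lab v u})
    (hdeg : ∀ v, IsLeaderOf F S lab v u → 3 ≤ (F.neighborSet v).ncard) :
    ((Set.ncard {v | IsLeaderOf F S lab v u} : ℕ) : ℕ∞) + 2 ≤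
      ((bagGraph F S lab).neighborSet u).encard := by
  classical
  set A : Set V := {v | IsLeaderOf F S lab v u} with hA
  haveI : Fintype A := hfin.fintype
  have huA : u ∈ A := isLeaderOf_self hu
  -- the bag induces a finite tree
  set T : SimpleGraph A := F.induce A with hT
  have hTconn : T.Connected := by
    haveI : Nonempty A := ⟨⟨u, huA⟩⟩
    refine ⟨fun a b => ?_⟩
    obtain ⟨p, hp⟩ := IsLeaderOf.exists_walk_of_isLeaderOf (F := F) (S := S) (lab := lab) a.2 b.2
    exact ⟨(p.induce A hp).copy (Subtype.ext rfl) (Subtype.ext rfl)⟩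
  have hTtree : T.IsTree := ⟨hTconn, hF.induce A⟩
  have hE := hTtree.card_edgeFinset
  have hsum := T.sum_degrees_eq_twice_card_edges
  -- degrees in `T` count the neighbours inside the bag
  have hdegT : ∀ a : A, T.degree a = (F.neighborSet a ∩ A).ncard := by
    intro a
    rw [← card_neighborFinset_eq_degree, ← Set.ncard_coe_finset]
    have himg : (↑(T.neighborFinset a) : Set A) = (fun b : A => (b : V)) ⁻¹' (F.neighborSet a ∩ A) := by
      ext b
      simp only [Finset.mem_coe, mem_neighborFinset, Set.mem_preimage, Set.mem_inter_iff,
        mem_neighborSet, Subtype.coe_prop, and_true]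
      exact Iff.rfl
    rw [himg, Set.ncard_preimage_of_injective_subset_range Subtype.coe_injective]
    rintro y ⟨-, hy⟩
    exact ⟨⟨y, hy⟩, rfl⟩
  -- `Σ_{a ∈ A} |N(a) ∩ A| + 2 = 2|A|`
  have hin : ∑ a : A, (F.neighborSet a ∩ A).ncard + 2 = 2 * Fintype.card A := by
    have h1 : ∑ a : A, (F.neighborSet a ∩ A).ncard = 2 * T.edgeFinset.card := by
      rw [← hsum]; exact Finset.sum_congr rfl fun a _ => (hdegT a).symm
    change T.edgeFinset.card + 1 = Fintype.card A at hE
    omega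
  -- the leaving edges: `out a = |N(a) ∖ A|`, with `in + out = deg ≥ 3`
  have hsplit : ∀ a : A, (F.neighborSet a ∩ A).ncard + (F.neighborSet a \ A).ncard = (F.neighborSet a).ncard :=
    fun a => Set.ncard_inter_add_ncard_sdiff_eq_ncard _ _ (hloc a)
  have hout : Fintype.card A + 2 ≤ ∑ a : A, (F.neighborSet a \ A).ncard := by
    have h3 : 3 * Fintype.card A ≤ ∑ a : A, (F.neighborSet a).ncard := by
      calc 3 * Fintype.card A = ∑ _a : A, 3 := by rw [Finset.sum_const, smul_eq_mul, mul_comm]; rfl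
        _ ≤ ∑ a : A, (F.neighborSet a).ncard := Finset.sum_le_sum fun a _ => hdeg a a.2
    have h4 : ∑ a : A, (F.neighborSet a).ncard =
        ∑ a : A, (F.neighborSet a ∩ A).ncard + ∑ a : A, (F.neighborSet a \ A).ncard := by
      rw [← Finset.sum_add_distrib]
      exact Finset.sum_congr rfl fun a _ => (hsplit a).symm
    omega
  -- the finite set of leaving darts `(a, b)`, `a ∈ A`, `b ∉ A`, `a ∼ b`
  set Df : Finset (V × V) := (Finset.univ : Finset A).biUnion fun a =>
    (((hloc a).sdiff (t := A)).toFinset).image (Prod.mk (a : V)) with hDf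
  have hmemDf : ∀ p : V × V, p ∈ Df ↔ p.1 ∈ A ∧ p.2 ∉ A ∧ F.Adj p.1 p.2 := by
    rintro ⟨a, b⟩
    simp only [hDf, Finset.mem_biUnion, Finset.mem_univ, true_and, Finset.mem_image,
      Set.Finite.mem_toFinset, Set.mem_sdiff, mem_neighborSet, Prod.mk.injEq]
    constructor
    · rintro ⟨a', b', ⟨hab, hb⟩, rfl, rfl⟩
      exact ⟨a'.2, hb, hab⟩
    · rintro ⟨ha, hb, hab⟩
      exact ⟨⟨a, ha⟩, b, ⟨hab, hb⟩, rfl, rfl⟩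
  have hDfcard : Df.card = ∑ a : A, (F.neighborSet a \ A).ncard := by
    rw [hDf, Finset.card_biUnion]
    · refine Finset.sum_congr rfl fun a _ => ?_
      rw [Finset.card_image_of_injective _ (Prod.mk_right_injective (a : V)),
        Set.ncard_eq_toFinset_card _ ((hloc a).sdiff (t := A))]
    · intro a _ a' _ hne
      rw [Function.onFun, Finset.disjoint_left]
      rintro ⟨x, y⟩ h1 h2
      rw [Finset.mem_image] at h1 h2
      obtain ⟨b₁, -, hb₁⟩ := h1
      obtain ⟨b₂, -, hb₂⟩ := h2
      rw [Prod.mk.injEq] at hb₁ hb₂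
      exact hne (Subtype.ext (hb₁.1.trans hb₂.1.symm))
  -- every outside neighbour has a leader, adjacent to `u` in the bag graph
  have hlead : ∀ p ∈ Df, ∃ u', IsLeaderOf F S lab p.2 u' ∧ (bagGraph F S lab).Adj u u' := by
    rintro ⟨a, b⟩ hp
    obtain ⟨ha, hb, hab⟩ := (hmemDf _).1 hp
    have hreach : F.Reachable b u := (Adj.reachable hab.symm).trans ha.reachable
    obtain ⟨u', hu'⟩ := exists_isLeaderOf (S := S) (lab := lab) hloc hu hreach
    refine ⟨u', hu', ?_, a, b, hab, ha, hu'⟩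
    rintro rfl
    exact hb hu'
  haveI : Nonempty V := ⟨u⟩
  choose! L hL using hlead
  -- distinct darts lead to distinct bags
  have hLinj : Set.InjOn L ↑Df := by
    rintro ⟨a₁, b₁⟩ hp₁ ⟨a₂, b₂⟩ hp₂ heq
    rw [Finset.mem_coe] at hp₁ hp₂
    obtain ⟨ha₁, hb₁, hab₁⟩ := (hmemDf _).1 hp₁
    obtain ⟨ha₂, hb₂, hab₂⟩ := (hmemDf _).1 hp₂
    by_contra hne
    have hne' : s(a₁, b₁) ≠ s(a₂, b₂) := by
      intro h
      rcases Sym2.eq_iff.1 h with ⟨rfl, rfl⟩ | ⟨rfl, rfl⟩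
      · exact hne rfl
      · exact hb₁ ha₂
    have h1 := (hL _ hp₁).1
    have h2 := (hL _ hp₂).1
    change IsLeaderOf F S lab b₁ (L (a₁, b₁)) at h1
    change IsLeaderOf F S lab b₂ (L (a₂, b₂)) at h2
    rw [heq] at h1
    exact leader_ne_of_ne hF hlab ha₁ ha₂ h1 h2 (hL _ hp₂).2.1 hab₁ hab₂ hne'
  have hLsub : L '' ↑Df ⊆ (bagGraph F S lab).neighborSet u := by
    rintro _ ⟨p, hp, rfl⟩
    exact (hL p hp).2
  -- assemble: `|A| + 2 ≤ Σ out = |Df| = |L '' Df| ≤ deg u`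
  have hcardA : A.ncard = Fintype.card A := by
    rw [← Nat.card_coe_set_eq, Nat.card_eq_fintype_card]
  calc ((A.ncard : ℕ) : ℕ∞) + 2 = ((Fintype.card A + 2 : ℕ) : ℕ∞) := by rw [hcardA]; push_cast; rfl
    _ ≤ ((Df.card : ℕ) : ℕ∞) := by rw [hDfcard]; exact_mod_cast hout
    _ = (↑Df : Set (V × V)).encard := (Set.encard_coe_eq_coe_finsetCard Df).symm
    _ = (L '' ↑Df).encard := (hLinj.encard_image).symm
    _ ≤ ((bagGraph F S lab).neighborSet u).encard := Set.encard_le_encard hLsub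

end Count

end Literature.Barriers.CriticalPhenomena
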